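import Summits.ValiantsHypothesis.ValiantsHypothesis.Theses.VPBoundarySquare
import Literature.Computability.AlgebraicComplexity.ApproximativeRootClosure
import Literature.Computability.AlgebraicComplexity.BorderComplexityZariski
import HarnessLib

/-!
# VPBoundarySquare — the presentable split of `CollapseEmptiesBoundary` and the U-ladder arrows
(decomp-valiant lens 3, NODE v6)

Closes the GLUE item of the split `CollapseEmptiesBoundary ⟸ CollapseDebordersPresentable ∧
PresentableCompletion` (`collapseEmptiesBoundaryOfPresentable_holds`) and records, as tree theorems
between the route's own decls, the WEAKER certificates of the ladder hanging off the lever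
`U = ClosureDefinable`:  `U → U_ε → P_ε`, `P → P_ε`, `U → U_root → P_root`, `P → P_root`, where the
root rung uses Bürgisser 2004 Thm 1.3 from the tree (`borderComplexity_le_of_isRoot`: p-degree roots
of p-size circuits of arbitrary degree lie in the closure of VP).
-/

noncomputable section

open MvPolynomial
open Literature.Computability.AlgebraicComplexity

namespace Summit.ValiantsHypothesis.ValiantsHypothesis.Theorems.VPBoundarySquarePresentableSplit

open Summit.ValiantsHypothesis.ValiantsHypothesis.Theses.VPBoundarySquare

/-- **GLUE PROVED** (split of `CollapseEmptiesBoundary`, gen 1): if the collapse de-borders the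
presentable closure and every border family is presentably approximable, the collapse closes VP.
[cite: BhargavDwivediSaxena2024, §1.2 (p. 5)] -/
theorem collapseEmptiesBoundaryOfPresentable_holds : CollapseEmptiesBoundaryOfPresentable :=
  fun hP hC hEq v f hpf hbar => hP hEq v f hpf (hC v f hpf hbar)

/-- Under `VP = VNP`, a `VNP` family on `Fin (v n)` is p-computable. [cite: Burgisser2000, Def. 2.4–2.5] -/
theorem isPComputable_of_isVNPFamily_of_vp_eq_vnp (hEq : VP ℂ = VNP ℂ) {v : ℕ → ℕ}
    {f : ∀ n, MvPolynomial (Fin (v n)) ℂ} (hf : IsVNPFamily f) : IsPComputable f := by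
  have hVNP : PolyFamily.ofFintype f ∈ VNP ℂ := (mem_VNP_ofFintype_iff_holds f).2 hf
  have hVP : PolyFamily.ofFintype f ∈ VP ℂ := by rw [hEq]; exact hVNP
  exact ((mem_VP_ofFintype_iff_holds f).1 hVP).2

/-- `U → U_ε`: closure-definability implies presentable-closure-definability (`VP̄_ε ⊆ VP̄`).
[cite: BhargavDwivediSaxena2024, §1.2 (p. 5)] -/
theorem closureDefinablePres_of_closureDefinable (hU : ClosureDefinable) : ClosureDefinablePres :=
  fun v f hpf hbar => hU v f hpf hbar.isVPBarFamily

/-- `P → P_ε` (the child is WEAKER than the parent). [cite: BhargavDwivediSaxena2024, §1.2 (p. 5)] -/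
theorem collapseDebordersPresentable_of_collapseEmptiesBoundary (hP : CollapseEmptiesBoundary) :
    CollapseDebordersPresentable :=
  fun hEq v f hpf hbar => hP hEq v f hpf hbar.isVPBarFamily

/-- `U_ε → P_ε` (the child's lever). [cite: BhargavDwivediSaxena2024, Thm. 1.3] -/
theorem collapseDebordersPresentable_of_closureDefinablePres (hU : ClosureDefinablePres) :
    CollapseDebordersPresentable :=
  fun hEq v f hpf hbar => isPComputable_of_isVNPFamily_of_vp_eq_vnp hEq (hU v f hpf hbar)

/-- `PresentableCompletion → U_ε → U` (the same split one level up, on the lever).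
[cite: BhargavDwivediSaxena2024, §1.2 (p. 5)] -/
theorem closureDefinable_of_presentableCompletion (hC : PresentableCompletion)
    (hU : ClosureDefinablePres) : ClosureDefinable :=
  fun v f hpf hbar => hU v f hpf (hC v f hpf hbar)

/-- **Bürgisser 2004 Thm 1.3 for families** (from the tree's `borderComplexity_le_of_isRoot`):
p-degree roots `φ_n` of nonzero p-size circuits `H_n(x, y)` of arbitrary degree lie in the closure
of VP. [cite: Burgisser2004Factors, Thm. 1.3] -/
theorem isVPBarFamily_of_isRoot {v : ℕ → ℕ} {φ : ∀ n, MvPolynomial (Fin (v n)) ℂ}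
    {H : ∀ n, MvPolynomial (Option (Fin (v n))) ℂ}
    (hroot : ∀ n, H n ≠ 0 ∧ bind₁ (fun o : Option (Fin (v n)) => o.elim (φ n) X) (H n) = 0)
    (hH : IsPComputable H) (hφ : IsPFamily φ) : IsVPBarFamily φ := by
  have hd : IsPBounded fun n => (φ n).totalDegree := hφ.2
  have hv : IsPBounded fun n => Fintype.card (Fin (v n)) := hφ.1
  have h1 : IsPBounded fun n => ((φ n).totalDegree + 2) ^ 2 :=
    IsPBounded.pow_holds (IsPBounded.add_holds hd (IsPBounded.const 2)) 2
  have h2 : IsPBounded fun n =>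
      (φ n).totalDegree * (complexity (H n) + Fintype.card (Fin (v n)) + 4) :=
    IsPBounded.mul_holds hd (IsPBounded.add_holds (IsPBounded.add_holds hH hv) (IsPBounded.const 4))
  have h3 : IsPBounded fun n =>
      ((φ n).totalDegree + 2) ^ 2 * ((φ n).totalDegree * (complexity (H n) +
        Fintype.card (Fin (v n)) + 4)) + ((φ n).totalDegree + 1) + Fintype.card (Fin (v n)) :=
    IsPBounded.add_holds (IsPBounded.add_holds (IsPBounded.mul_holds h1 h2)
      (IsPBounded.add_holds hd (IsPBounded.const 1))) hv
  exact h3.mono fun n => (approxComplexity_le_borderComplexity (φ n)).trans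
    (borderComplexity_le_of_isRoot (φ n) (hroot n).1 (hroot n).2 le_rfl)

/-- `U → U_root`: closure-definability puts roots of small circuits in VNP. [cite: Burgisser2004Factors, Thm. 1.3] -/
theorem rootsDefinable_of_closureDefinable (hU : ClosureDefinable) : RootsDefinable :=
  fun v φ _ hroot hH hφ => hU v φ hφ (isVPBarFamily_of_isRoot hroot hH hφ)

/-- `P → P_root`: under the collapse, `P` gives the Factor Conjecture (root form). [cite: Burgisser2004Factors, Thm. 1.3] -/
theorem collapseComputesRoots_of_collapseEmptiesBoundary (hP : CollapseEmptiesBoundary) :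
    CollapseComputesRoots :=
  fun hEq v φ _ hroot hH hφ => hP hEq v φ hφ (isVPBarFamily_of_isRoot hroot hH hφ)

/-- `U_root → P_root` (the bottom rung's lever). [cite: Burgisser2000, Def. 2.4–2.5] -/
theorem collapseComputesRoots_of_rootsDefinable (hU : RootsDefinable) : CollapseComputesRoots :=
  fun hEq v φ H hroot hH hφ => isPComputable_of_isVNPFamily_of_vp_eq_vnp hEq (hU v φ H hroot hH hφ)

/-- FACE of `M`: if the collapse does NOT compute roots (a Factor-Conjecture counterexample under
`VP = VNP`), the boundary of VP is non-empty. [cite: Burgisser2004Factors, Thm. 1.3] -/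
theorem boundaryOfVPNonempty_of_not_collapseComputesRoots (h : ¬ CollapseComputesRoots) :
    BoundaryOfVPNonempty := fun hD =>
  h fun _ v φ _ hroot hH hφ => hD v φ hφ (isVPBarFamily_of_isRoot hroot hH hφ)

end Summit.ValiantsHypothesis.ValiantsHypothesis.Theorems.VPBoundarySquarePresentableSplit

end
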